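import Literature.Probability.RandomPlanarGeometry.SchwarzChristoffelTriangle
import Literature.Probability.RandomPlanarGeometry.CardyFunctionIncBeta
import Literature.Probability.RandomPlanarGeometry.ObliqueRBMWedgeDynkin
import HarnessLib

/-!
# The uniformising map of the canonical triangle and its inverse up to the boundary

Layer of the proof of
`Literature.Probability.RandomPlanarGeometry.LawlerSchrammWerner2001_orbm_uniformHitting`
(`ObliqueRBMWedge.lean`). The PROVED Schwarz–Christoffel map `scPsi : ℍ → T₀` of
`SchwarzChristoffelTriangle.lean` (reference triangle `(1, ζ, 0)`), its continuous extension
`scPsiExt` to the closed half-plane and the affine map `sigmaC N p = N((1 − p) + p ζ)` (which is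
`oppositeSideParam N` on the real segment `[0,1]` and sends `ζ ↦ 0`, `[0,1] ↦` the opposite side
at level `N`) give a continuous bijection

  `PsiC N = sigmaC N ∘ scPsiExt : {im ≥ 0} → levelRegion N ∖ {0}`

onto the closed canonical triangle minus its apex. We prove injectivity (interior/boundary
classification of values), surjectivity (intermediate values of the beta ratio `scRatio`),
continuity of the inverse `wInv N` on `levelRegion N ∖ {0}` (compactness / unique cluster point),
its blow-up at the apex, the side correspondences, and the holomorphy of `wInv N` on the open
triangle with the inverse-function derivative.

## References

* C. A. Berenstein, R. Gay, *Complex Variables* (1991), §2.8 (Schwarz–Christoffel);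
  Ch. Pommerenke, *Boundary Behaviour of Conformal Maps* (1992), §2.1. [folklore]
-/

noncomputable section

open Set Filter Topology Complex Metric
open scoped Real
open UpperHalfPlane (upperHalfPlaneSet isOpen_upperHalfPlaneSet)

namespace Literature.Probability.RandomPlanarGeometry

/-! ### The beta ratio `scRatio` as a homeomorphism of `[0, 1]` -/

/-- Auxiliary statement (`scRatio_zero`). [folklore] -/
@[simp] theorem scRatio_zero : scRatio 0 = 0 := by simp [scRatio, incBeta13_zero]

/-- Auxiliary statement (`scRatio_one`). [folklore] -/
@[simp] theorem scRatio_one : scRatio 1 = 1 := by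
  rw [scRatio, div_self incBeta13_one_pos.ne']

/-- Auxiliary statement (`continuousOn_scRatio`). [folklore] -/
theorem continuousOn_scRatio : ContinuousOn scRatio (Icc 0 1) :=
  incBeta13_continuousOn.div_const _

/-- Auxiliary statement (`strictMonoOn_scRatio`). [folklore] -/
theorem strictMonoOn_scRatio : StrictMonoOn scRatio (Icc 0 1) := fun _ ha _ hb hab ↦
  div_lt_div_of_pos_right (strictMonoOn_incBeta13 ha hb hab) incBeta13_one_pos

/-- **Intermediate values**: every `s ∈ [0, 1]` is a value `scRatio u`, `u ∈ [0, 1]`. [folklore] -/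
theorem exists_scRatio_eq {s : ℝ} (hs : s ∈ Icc (0:ℝ) 1) : ∃ u ∈ Icc (0:ℝ) 1, scRatio u = s := by
  have h := intermediate_value_Icc zero_le_one continuousOn_scRatio
  rw [scRatio_zero, scRatio_one] at h
  exact h hs

/-- The inverse beta ratio on `[0, 1]` (junk value `0` outside). [folklore] -/
def scRatioInv (s : ℝ) : ℝ := if h : s ∈ Icc (0:ℝ) 1 then (exists_scRatio_eq h).choose else 0

/-- Auxiliary statement (`scRatioInv_mem`). [folklore] -/
theorem scRatioInv_mem {s : ℝ} (hs : s ∈ Icc (0:ℝ) 1) : scRatioInv s ∈ Icc (0:ℝ) 1 := by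
  rw [scRatioInv, dif_pos hs]; exact (exists_scRatio_eq hs).choose_spec.1

/-- Auxiliary statement (`scRatio_scRatioInv`). [folklore] -/
theorem scRatio_scRatioInv {s : ℝ} (hs : s ∈ Icc (0:ℝ) 1) : scRatio (scRatioInv s) = s := by
  rw [scRatioInv, dif_pos hs]; exact (exists_scRatio_eq hs).choose_spec.2

/-- Auxiliary statement (`scRatioInv_scRatio`). [folklore] -/
theorem scRatioInv_scRatio {u : ℝ} (hu : u ∈ Icc (0:ℝ) 1) : scRatioInv (scRatio u) = u :=
  strictMonoOn_scRatio.injOn (scRatioInv_mem (scRatio_mem_Icc hu)) hu (scRatio_scRatioInv (scRatio_mem_Icc hu))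

/-- Auxiliary statement (`scRatioInv_mem_Ioo`). [folklore] -/
theorem scRatioInv_mem_Ioo {s : ℝ} (hs : s ∈ Ioo (0:ℝ) 1) : scRatioInv s ∈ Ioo (0:ℝ) 1 := by
  have hs' : s ∈ Icc (0:ℝ) 1 := ⟨hs.1.le, hs.2.le⟩
  have hm := scRatioInv_mem hs'
  refine ⟨lt_of_le_of_ne hm.1 fun h ↦ ?_, lt_of_le_of_ne hm.2 fun h ↦ ?_⟩
  · have := scRatio_scRatioInv hs'; rw [← h, scRatio_zero] at this; linarith [hs.1]
  · have := scRatio_scRatioInv hs'; rw [h, scRatio_one] at this; linarith [hs.2]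

/-! ### Boundary values of the extension `scPsiExt` -/

/-- Auxiliary statement (`scPsiExt_ofReal_eq_of_tendsto`). [folklore] -/
theorem scPsiExt_ofReal_eq_of_tendsto {u : ℝ} {p : ℂ} (h : Tendsto scPsi (𝓝[upperHalfPlaneSet] (u : ℂ)) (𝓝 p)) :
    scPsiExt u = p :=
  extendFrom_eq (mem_closure_upperHalfPlaneSet_iff.2 (by simp)) h

/-- On `[0, 1]`: `scPsiExt u = scRatio u`. [folklore] -/
theorem scPsiExt_ofReal_of_mem_Icc {u : ℝ} (hu : u ∈ Icc (0:ℝ) 1) : scPsiExt u = ((scRatio u : ℝ) : ℂ) :=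
  scPsiExt_ofReal_eq_of_tendsto (tendsto_scPsi_of_mem_Icc hu)

/-- On `(−∞, 0)`: `scPsiExt v = (1 − s) ζ`, `s = scRatio((1−v)⁻¹)`. [folklore] -/
theorem scPsiExt_ofReal_of_neg {v : ℝ} (hv : v < 0) :
    scPsiExt v = ((1 - scRatio ((1 - v)⁻¹) : ℝ) : ℂ) * equilateralApex :=
  scPsiExt_ofReal_eq_of_tendsto (tendsto_scPsi_of_neg hv)

/-- On `(1, ∞)`: `scPsiExt v = (1 − s) + s ζ`, `s = scRatio(1 − v⁻¹)`. [folklore] -/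
theorem scPsiExt_ofReal_of_one_lt {v : ℝ} (hv : 1 < v) :
    scPsiExt v = ((1 - scRatio (1 - v⁻¹) : ℝ) : ℂ) + (scRatio (1 - v⁻¹) : ℂ) * equilateralApex :=
  scPsiExt_ofReal_eq_of_tendsto (tendsto_scPsi_of_one_lt hv)

/-- Auxiliary statement (`inv_one_sub_mem_Ioo`). [folklore] -/
theorem inv_one_sub_mem_Ioo {v : ℝ} (hv : v < 0) : (1 - v)⁻¹ ∈ Ioo (0:ℝ) 1 :=
  ⟨inv_pos.2 (by linarith), inv_lt_one_of_one_lt₀ (by linarith)⟩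

/-- Auxiliary statement (`one_sub_inv_mem_Ioo`). [folklore] -/
theorem one_sub_inv_mem_Ioo {v : ℝ} (hv : 1 < v) : 1 - v⁻¹ ∈ Ioo (0:ℝ) 1 :=
  ⟨by rw [sub_pos]; exact inv_lt_one_of_one_lt₀ hv, by simp [inv_pos.2 (zero_lt_one.trans hv)]⟩

/-! ### Reference-triangle coordinates -/

/-- The first reference coordinate `X(p) = 1 − re p − im p/√3` (`= quadX(σ p)/N`). [folklore] -/
def refX (p : ℂ) : ℝ := 1 - p.re - p.im / Real.sqrt 3

/-- The second reference coordinate `Y(p) = re p − im p/√3` (`= quadY(σ p)/N`). [folklore] -/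
def refY (p : ℂ) : ℝ := p.re - p.im / Real.sqrt 3

/-- Auxiliary statement (`refX_add_refY`). [folklore] -/
theorem refX_add_refY (p : ℂ) : refX p + refY p = 1 - 2 * p.im / Real.sqrt 3 := by
  unfold refX refY; ring

/-- Points of the open reference triangle satisfy the three strict inequalities. [folklore] -/
theorem strict_of_mem_refEquilateralTriangle {q : ℂ} (hq : q ∈ refEquilateralTriangle) :
    0 < q.im ∧ Real.sqrt 3 * q.re + q.im < Real.sqrt 3 ∧ 0 < Real.sqrt 3 * q.re - q.im := by
  rw [← scPsi_image_eq] at hq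
  have hn := not_mem_closure_scOuter_of_mem_image hq
  have h1 : 0 < q.im := scPsi_image_subset_upperHalfPlaneSet hq
  have hn' := not_mem_scOuter_of_mem_image hq
  have h2 : Real.sqrt 3 * q.re + q.im < Real.sqrt 3 := by
    by_contra h
    rcases (not_lt.1 h).eq_or_lt with h | h
    · exact hn 1 (mem_closure_openHalfPlane (by positivity) (by simpa using h.symm))
    · exact hn' 1 (by simpa [scOuter, openHalfPlane] using h)
  have h3 : 0 < Real.sqrt 3 * q.re - q.im := by
    by_contra h
    rcases (not_lt.1 h).eq_or_lt with h | h
    · exact hn 2 (mem_closure_openHalfPlane (by positivity) (by simp; linarith))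
    · exact hn' 2 (by simp [scOuter, openHalfPlane]; linarith)
  exact ⟨h1, h2, h3⟩

/-- Auxiliary statement (`sqrt3_pos`). [folklore] -/
theorem sqrt3_pos : 0 < Real.sqrt 3 := by positivity

/-- Auxiliary statement (`sqrt3_sq`). [folklore] -/
theorem sqrt3_mul_self : Real.sqrt 3 * Real.sqrt 3 = 3 := Real.mul_self_sqrt (by norm_num)

/-- **Interior points**: `0 < X`, `0 < Y`, `0 < im` for `p ∈ T₀`. [folklore] -/
theorem refX_pos_of_mem {p : ℂ} (hp : p ∈ refEquilateralTriangle) : 0 < refX p := by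
  obtain ⟨_, h2, _⟩ := strict_of_mem_refEquilateralTriangle hp
  unfold refX
  have h3 := sqrt3_pos
  rw [show 1 - p.re - p.im / Real.sqrt 3 = (Real.sqrt 3 - (Real.sqrt 3 * p.re + p.im)) / Real.sqrt 3 by
    field_simp; ring]
  exact div_pos (by linarith) h3

/-- Auxiliary statement (`refY_pos_of_mem`). [folklore] -/
theorem refY_pos_of_mem {p : ℂ} (hp : p ∈ refEquilateralTriangle) : 0 < refY p := by
  obtain ⟨_, _, h3⟩ := strict_of_mem_refEquilateralTriangle hp
  unfold refY
  have h := sqrt3_pos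
  rw [show p.re - p.im / Real.sqrt 3 = (Real.sqrt 3 * p.re - p.im) / Real.sqrt 3 by field_simp]
  exact div_pos h3 h

/-- Membership in `T₀` from the strict inequalities. [folklore] -/
theorem mem_refEquilateralTriangle_of_strict {z : ℂ} (h1 : 0 < z.im) (h2 : Real.sqrt 3 * z.re + z.im < Real.sqrt 3)
    (h3 : 0 < Real.sqrt 3 * z.re - z.im) : z ∈ refEquilateralTriangle := by
  -- the strict set is open and contained in the convex hull
  have hopen : IsOpen {z : ℂ | 0 < z.im ∧ Real.sqrt 3 * z.re + z.im < Real.sqrt 3 ∧ 0 < Real.sqrt 3 * z.re - z.im} := by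
    refine (isOpen_lt continuous_const continuous_im).inter ((isOpen_lt
      ((continuous_const.mul continuous_re).add continuous_im) continuous_const).inter
      (isOpen_lt continuous_const ((continuous_const.mul continuous_re).sub continuous_im)))
  have hsub : {z : ℂ | 0 < z.im ∧ Real.sqrt 3 * z.re + z.im < Real.sqrt 3 ∧ 0 < Real.sqrt 3 * z.re - z.im} ⊆
      convexHull ℝ ({(1 : ℂ), equilateralApex, 0} : Set ℂ) := fun z hz ↦ mem_convexHull_of_strict hz.1 hz.2.1 hz.2.2
  exact interior_maximal hsub hopen ⟨h1, h2, h3⟩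

/-- Membership in `T₀` from positivity of the reference coordinates and of `im`. [folklore] -/
theorem mem_refEquilateralTriangle_of_ref {p : ℂ} (h1 : 0 < p.im) (hX : 0 < refX p) (hY : 0 < refY p) :
    p ∈ refEquilateralTriangle := by
  have h3 := sqrt3_pos
  have hsq := sqrt3_mul_self
  refine mem_refEquilateralTriangle_of_strict h1 ?_ ?_
  · unfold refX at hX
    have : 0 < (1 - p.re - p.im / Real.sqrt 3) * Real.sqrt 3 := mul_pos hX h3
    have e : (1 - p.re - p.im / Real.sqrt 3) * Real.sqrt 3 = Real.sqrt 3 - Real.sqrt 3 * p.re - p.im := by field_simp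
    linarith
  · unfold refY at hY
    have : 0 < (p.re - p.im / Real.sqrt 3) * Real.sqrt 3 := mul_pos hY h3
    have e : (p.re - p.im / Real.sqrt 3) * Real.sqrt 3 = Real.sqrt 3 * p.re - p.im := by field_simp
    linarith

/-- Coordinates of a real point `s`: `X = 1 − s`, `Y = s`. [folklore] -/
theorem ref_ofReal (s : ℝ) : refX s = 1 - s ∧ refY s = s ∧ (s : ℂ).im = 0 := by
  simp [refX, refY]

/-- Coordinates of `t ζ`: `X = 1 − t`, `Y = 0`, `im = t √3/2`. [folklore] -/
theorem ref_mul_apex (t : ℝ) : refX ((t : ℂ) * equilateralApex) = 1 - t ∧ refY ((t : ℂ) * equilateralApex) = 0 ∧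
    ((t : ℂ) * equilateralApex).im = t * (Real.sqrt 3 / 2) := by
  have h3 := sqrt3_pos.ne'
  simp only [refX, refY, mul_re, ofReal_re, equilateralApex_re, ofReal_im, equilateralApex_im, zero_mul, sub_zero,
    mul_im, add_zero]
  refine ⟨?_, ?_, trivial⟩ <;> field_simp <;> ring

/-- Coordinates of `(1 − t) + t ζ`: `X = 0`, `Y = 1 − t`, `im = t √3/2`. [folklore] -/
theorem ref_side_point (t : ℝ) : refX (((1 - t : ℝ) : ℂ) + (t : ℂ) * equilateralApex) = 0 ∧
    refY (((1 - t : ℝ) : ℂ) + (t : ℂ) * equilateralApex) = 1 - t ∧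
    (((1 - t : ℝ) : ℂ) + (t : ℂ) * equilateralApex).im = t * (Real.sqrt 3 / 2) := by
  have h3 := sqrt3_pos.ne'
  simp only [refX, refY, add_re, ofReal_re, mul_re, equilateralApex_re, ofReal_im, equilateralApex_im, zero_mul,
    sub_zero, add_im, mul_im, add_zero, zero_add]
  refine ⟨?_, ?_, trivial⟩ <;> field_simp <;> ring

/-! ### Classification of the values of `scPsiExt` on the closed half-plane -/

/-- The four kinds of points of the closed half-plane and the corresponding values. [folklore] -/
theorem scPsiExt_cases {w : ℂ} (hw : 0 ≤ w.im) :
    (0 < w.im ∧ scPsiExt w ∈ refEquilateralTriangle) ∨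
    (w.im = 0 ∧ w.re ∈ Icc (0:ℝ) 1 ∧ scPsiExt w = ((scRatio w.re : ℝ) : ℂ)) ∨
    (w.im = 0 ∧ w.re < 0 ∧ scPsiExt w = ((1 - scRatio ((1 - w.re)⁻¹) : ℝ) : ℂ) * equilateralApex) ∨
    (w.im = 0 ∧ 1 < w.re ∧ scPsiExt w = ((1 - scRatio (1 - w.re⁻¹) : ℝ) : ℂ) + (scRatio (1 - w.re⁻¹) : ℂ) * equilateralApex) := by
  rcases hw.lt_or_eq with h | h
  · left
    refine ⟨h, ?_⟩
    rw [scPsiExt_eq h, ← scPsi_image_eq]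
    exact ⟨w, h, rfl⟩
  · right
    have hwre : ((w.re : ℝ) : ℂ) = w := Complex.ext (by simp) (by simp [← h])
    rcases lt_or_ge w.re 0 with hneg | hnn
    · right; left
      exact ⟨h.symm, hneg, by rw [← hwre, scPsiExt_ofReal_of_neg hneg]; simp⟩
    rcases le_or_gt w.re 1 with hle | hgt
    · left
      exact ⟨h.symm, ⟨hnn, hle⟩, by rw [← hwre, scPsiExt_ofReal_of_mem_Icc ⟨hnn, hle⟩]; simp⟩
    · right; right
      exact ⟨h.symm, hgt, by rw [← hwre, scPsiExt_ofReal_of_one_lt hgt]; simp⟩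

/-- **The apex `ζ` is not attained** on the closed half-plane. [folklore] -/
theorem scPsiExt_ne_apex {w : ℂ} (hw : 0 ≤ w.im) : scPsiExt w ≠ equilateralApex := by
  intro heq
  rcases scPsiExt_cases hw with ⟨_, hm⟩ | ⟨_, _, hv⟩ | ⟨_, hre, hv⟩ | ⟨_, hre, hv⟩
  · rw [heq] at hm
    have := (strict_of_mem_refEquilateralTriangle hm).2.2
    simp at this
    nlinarith [sqrt3_mul_self]
  · rw [heq] at hv
    have := congrArg Complex.im hv
    simp at this
  · rw [heq] at hv
    have h1 := congrArg Complex.im hv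
    simp only [mul_im, ofReal_re, equilateralApex_im, ofReal_im, equilateralApex_re, zero_mul, add_zero] at h1
    have hs := (scRatio_mem_Ioo (inv_one_sub_mem_Ioo hre)).1
    have h3 := sqrt3_pos
    nlinarith
  · rw [heq] at hv
    have h1 := congrArg Complex.re hv
    have h2 := congrArg Complex.im hv
    simp only [add_re, ofReal_re, mul_re, equilateralApex_re, ofReal_im, equilateralApex_im, zero_mul, sub_zero,
      add_im, mul_im, add_zero, zero_add] at h1 h2
    have hs := (scRatio_mem_Ioo (one_sub_inv_mem_Ioo hre)).2
    have h3 := sqrt3_pos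
    nlinarith

/-- Auxiliary statement (`strictMono_param_neg`): `v ↦ 1 − scRatio((1−v)⁻¹)` is injective on
`(−∞, 0)`. [folklore] -/
theorem injOn_param_neg : InjOn (fun v : ℝ ↦ 1 - scRatio ((1 - v)⁻¹)) (Iio 0) := by
  intro a ha b hb h
  simp only at h
  have ha' := inv_one_sub_mem_Ioo (mem_Iio.1 ha)
  have hb' := inv_one_sub_mem_Ioo (mem_Iio.1 hb)
  have h1 : scRatio ((1 - a)⁻¹) = scRatio ((1 - b)⁻¹) := by linarith
  have h2 := strictMonoOn_scRatio.injOn ⟨ha'.1.le, ha'.2.le⟩ ⟨hb'.1.le, hb'.2.le⟩ h1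
  have h3 : 1 - a = 1 - b := inv_injective h2
  linarith

/-- Auxiliary statement (`injOn_param_one_lt`): `v ↦ scRatio(1 − v⁻¹)` is injective on `(1, ∞)`.
[folklore] -/
theorem injOn_param_one_lt : InjOn (fun v : ℝ ↦ scRatio (1 - v⁻¹)) (Ioi 1) := by
  intro a ha b hb h
  simp only at h
  have ha' := one_sub_inv_mem_Ioo (mem_Ioi.1 ha)
  have hb' := one_sub_inv_mem_Ioo (mem_Ioi.1 hb)
  have h2 := strictMonoOn_scRatio.injOn ⟨ha'.1.le, ha'.2.le⟩ ⟨hb'.1.le, hb'.2.le⟩ h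
  have h3 : a⁻¹ = b⁻¹ := by linarith
  exact inv_injective h3

/-- **Injectivity of `scPsiExt` on the closed half-plane.** [folklore] -/
theorem scPsiExt_injOn : InjOn scPsiExt {w : ℂ | 0 ≤ w.im} := by
  intro a ha b hb hab
  have h3 := sqrt3_pos
  have hsq := sqrt3_mul_self
  rcases scPsiExt_cases ha with ⟨ha1, ham⟩ | ⟨ha1, har, hav⟩ | ⟨ha1, har, hav⟩ | ⟨ha1, har, hav⟩ <;>
    rcases scPsiExt_cases hb with ⟨hb1, hbm⟩ | ⟨hb1, hbr, hbv⟩ | ⟨hb1, hbr, hbv⟩ | ⟨hb1, hbr, hbv⟩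
  -- interior / interior
  · rw [scPsiExt_eq ha1, scPsiExt_eq hb1] at hab
    exact scPsi_injOn ha1 hb1 hab
  -- interior vs boundary classes: the interior value has `im > 0`, `X > 0`, `Y > 0`
  · exfalso
    have := (strict_of_mem_refEquilateralTriangle ham).1
    rw [hab, hbv] at this; simp at this
  · exfalso
    have := refY_pos_of_mem ham
    rw [hab, hbv, (ref_mul_apex _).2.1] at this; exact lt_irrefl _ this
  · exfalso
    have := refX_pos_of_mem ham
    rw [hab, hbv, (ref_side_point _).1] at this; exact lt_irrefl _ this
  · exfalso
    have := (strict_of_mem_refEquilateralTriangle hbm).1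
    rw [← hab, hav] at this; simp at this
  -- real / real
  · rw [hav, hbv] at hab
    have h := strictMonoOn_scRatio.injOn har hbr (by exact_mod_cast hab)
    exact Complex.ext h (by rw [ha1, hb1])
  · exfalso
    have := congrArg Complex.im hab
    rw [hav, hbv, (ref_mul_apex _).2.2] at this
    simp only [ofReal_im] at this
    have hs := (scRatio_mem_Ioo (inv_one_sub_mem_Ioo hbr)).2
    nlinarith
  · exfalso
    have := congrArg Complex.im hab
    rw [hav, hbv, (ref_side_point _).2.2] at this
    simp only [ofReal_im] at this
    have hs := (scRatio_mem_Ioo (one_sub_inv_mem_Ioo hbr)).1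
    nlinarith
  · exfalso
    have := refY_pos_of_mem hbm
    rw [← hab, hav, (ref_mul_apex _).2.1] at this; exact lt_irrefl _ this
  · exfalso
    have := congrArg Complex.im hab
    rw [hav, hbv, (ref_mul_apex _).2.2] at this
    simp only [ofReal_im] at this
    have hs := (scRatio_mem_Ioo (inv_one_sub_mem_Ioo har)).2
    nlinarith
  -- side (ζ,0) / side (ζ,0)
  · have h := congrArg refX hab
    rw [hav, hbv, (ref_mul_apex _).1, (ref_mul_apex _).1] at h
    have h' : 1 - scRatio ((1 - a.re)⁻¹) = 1 - scRatio ((1 - b.re)⁻¹) := by linarith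
    have := injOn_param_neg har hbr h'
    exact Complex.ext this (by rw [ha1, hb1])
  · exfalso
    -- `t ζ = (1 - t') + t' ζ`: compare `X`: `1 - t = 0` impossible since `t < 1`
    have h := congrArg refX hab
    rw [hav, hbv, (ref_mul_apex _).1, (ref_side_point _).1] at h
    have hs := (scRatio_mem_Ioo (inv_one_sub_mem_Ioo har)).1
    linarith
  · exfalso
    have := refX_pos_of_mem hbm
    rw [← hab, hav, (ref_side_point _).1] at this; exact lt_irrefl _ this
  · exfalso
    have := congrArg Complex.im hab
    rw [hav, hbv, (ref_side_point _).2.2] at this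
    simp only [ofReal_im] at this
    have hs := (scRatio_mem_Ioo (one_sub_inv_mem_Ioo har)).1
    nlinarith
  · exfalso
    have h := congrArg refX hab
    rw [hav, hbv, (ref_mul_apex _).1, (ref_side_point _).1] at h
    have hs := (scRatio_mem_Ioo (inv_one_sub_mem_Ioo hbr)).1
    linarith
  -- side (1,ζ) / side (1,ζ)
  · have h := congrArg refY hab
    rw [hav, hbv, (ref_side_point _).2.1, (ref_side_point _).2.1] at h
    have h' : scRatio (1 - a.re⁻¹) = scRatio (1 - b.re⁻¹) := by linarith
    have := injOn_param_one_lt har hbr h'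
    exact Complex.ext this (by rw [ha1, hb1])

/-! ### The affine map `σ_N` from the reference triangle to the canonical triangle -/

/-- `dirSixty = ζ` (the two names of `e^{iπ/3}` in the tree). [folklore] -/
theorem dirSixty_eq_equilateralApex : dirSixty = equilateralApex := by
  rw [dirSixty_eq]; rfl

/-- `a/√3 = a√3/3`. [folklore] -/
theorem div_sqrt3 (a : ℝ) : a / Real.sqrt 3 = a * Real.sqrt 3 / 3 := by
  rw [div_eq_mul_one_div, ← Real.sqrt_div_self', mul_div_assoc]

/-- Auxiliary statement (`quadX_eq'`). [folklore] -/
theorem quadX_eq' (z : ℂ) : quadX z = z.re - z.im * Real.sqrt 3 / 3 := by rw [quadX, div_sqrt3]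

/-- Auxiliary statement (`quadY_eq'`). [folklore] -/
theorem quadY_eq' (z : ℂ) : quadY z = 2 * z.im * Real.sqrt 3 / 3 := by rw [quadY, div_sqrt3]

/-- Auxiliary statement (`refX_eq'`). [folklore] -/
theorem refX_eq' (p : ℂ) : refX p = 1 - p.re - p.im * Real.sqrt 3 / 3 := by rw [refX, div_sqrt3]

/-- Auxiliary statement (`refY_eq'`). [folklore] -/
theorem refY_eq' (p : ℂ) : refY p = p.re - p.im * Real.sqrt 3 / 3 := by rw [refY, div_sqrt3]

/-- A point is determined by its two reference coordinates. [folklore] -/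
theorem ext_ref {p q : ℂ} (hX : refX p = refX q) (hY : refY p = refY q) : p = q := by
  rw [refX_eq', refX_eq'] at hX
  rw [refY_eq', refY_eq'] at hY
  have h3 := sqrt3_pos
  have hre : p.re = q.re := by linarith
  apply Complex.ext hre
  have : p.im * Real.sqrt 3 = q.im * Real.sqrt 3 := by linarith
  exact mul_right_cancel₀ h3.ne' this

/-- **The affine map** `σ_N(p) = N((1 − p) + p ζ)`: the complex-affine extension of
`oppositeSideParam N`; it maps `0 ↦ N`, `1 ↦ Nζ`, `ζ ↦ 0`. [folklore] -/
def sigmaC (N : ℝ) (p : ℂ) : ℂ := (N : ℂ) * ((1 - p) + p * dirSixty)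

/-- Auxiliary statement (`sigmaC_ofReal`). [folklore] -/
theorem sigmaC_ofReal (N s : ℝ) : sigmaC N s = oppositeSideParam N s := rfl

/-- Auxiliary statement (`dirSixty_sub_one_ne_zero`). [folklore] -/
theorem dirSixty_sub_one_ne_zero : dirSixty - 1 ≠ 0 := by
  intro h
  have := congrArg Complex.im h
  rw [dirSixty_eq] at this
  simp at this

/-- The inverse affine map `σ_N⁻¹(z) = (z/N − 1)/(ζ − 1)`. [folklore] -/
def sigmaInvC (N : ℝ) (z : ℂ) : ℂ := (z / N - 1) / (dirSixty - 1)

/-- Auxiliary statement (`sigmaC_eq`). [folklore] -/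
theorem sigmaC_eq (N : ℝ) (p : ℂ) : sigmaC N p = N * (1 + p * (dirSixty - 1)) := by
  unfold sigmaC; ring

/-- Auxiliary statement (`sigmaInvC_sigmaC`). [folklore] -/
theorem sigmaInvC_sigmaC {N : ℝ} (hN : N ≠ 0) (p : ℂ) : sigmaInvC N (sigmaC N p) = p := by
  have hN' : (N : ℂ) ≠ 0 := ofReal_ne_zero.2 hN
  rw [sigmaInvC, sigmaC_eq]
  field_simp [dirSixty_sub_one_ne_zero]
  ring

/-- Auxiliary statement (`sigmaC_sigmaInvC`). [folklore] -/
theorem sigmaC_sigmaInvC {N : ℝ} (hN : N ≠ 0) (z : ℂ) : sigmaC N (sigmaInvC N z) = z := by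
  have hN' : (N : ℂ) ≠ 0 := ofReal_ne_zero.2 hN
  rw [sigmaC_eq, sigmaInvC]
  field_simp [dirSixty_sub_one_ne_zero]
  ring

/-- Auxiliary statement (`sigmaC_injective`). [folklore] -/
theorem sigmaC_injective {N : ℝ} (hN : N ≠ 0) : Function.Injective (sigmaC N) := fun a b h ↦ by
  rw [← sigmaInvC_sigmaC hN a, h, sigmaInvC_sigmaC hN b]

/-- Auxiliary statement (`continuous_sigmaC`). [folklore] -/
theorem continuous_sigmaC (N : ℝ) : Continuous (sigmaC N) := by unfold sigmaC; fun_prop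

/-- Auxiliary statement (`continuous_sigmaInvC`). [folklore] -/
theorem continuous_sigmaInvC (N : ℝ) : Continuous (sigmaInvC N) := by unfold sigmaInvC; fun_prop

/-- Auxiliary statement (`hasDerivAt_sigmaC`). [folklore] -/
theorem hasDerivAt_sigmaC (N : ℝ) (p : ℂ) : HasDerivAt (sigmaC N) ((N : ℂ) * (dirSixty - 1)) p := by
  have h : HasDerivAt (fun p : ℂ ↦ (N : ℂ) * (1 + p * (dirSixty - 1))) ((N : ℂ) * (0 + 1 * (dirSixty - 1))) p :=
    ((hasDerivAt_const p (1:ℂ)).add ((hasDerivAt_id p).mul_const _)).const_mul _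
  simp only [zero_add, one_mul] at h
  exact h.congr_of_eventuallyEq (Eventually.of_forall fun q ↦ sigmaC_eq N q)

/-- Auxiliary statement (`sigmaC_re`). [folklore] -/
theorem sigmaC_re (N : ℝ) (p : ℂ) : (sigmaC N p).re = N * (1 - p.re / 2 - p.im * (Real.sqrt 3 / 2)) := by
  rw [sigmaC, dirSixty_eq]
  simp only [mul_re, ofReal_re, add_re, sub_re, one_re, mul_im, ofReal_im, add_im, sub_im, one_im, zero_sub,
    zero_mul, sub_zero]
  ring

/-- Auxiliary statement (`sigmaC_im`). [folklore] -/
theorem sigmaC_im (N : ℝ) (p : ℂ) : (sigmaC N p).im = N * (p.re * (Real.sqrt 3 / 2) - p.im / 2) := by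
  rw [sigmaC, dirSixty_eq]
  simp only [mul_im, ofReal_re, add_im, sub_im, one_im, mul_re, ofReal_im, add_re, sub_re, one_re, zero_sub,
    zero_mul, add_zero]
  ring

/-- Auxiliary statement (`sigmaC_apex`). [folklore] -/
theorem sigmaC_apex (N : ℝ) : sigmaC N equilateralApex = 0 := by
  apply Complex.ext
  · rw [sigmaC_re, equilateralApex_re, equilateralApex_im, zero_re]
    have h : Real.sqrt 3 / 2 * (Real.sqrt 3 / 2) = 3 / 4 := by nlinarith [sqrt3_mul_self]
    rw [h]; ring
  · rw [sigmaC_im, equilateralApex_re, equilateralApex_im, zero_im]; ring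

/-- **Canonical coordinates of `σ_N(p)`**: `quadX = N·X(p)`, `quadY = N·Y(p)`. [folklore] -/
theorem quadX_sigmaC (N : ℝ) (p : ℂ) : quadX (sigmaC N p) = N * refX p := by
  rw [quadX_eq', sigmaC_re, sigmaC_im, refX_eq']
  linear_combination (-(N * p.re / 6)) * sqrt3_mul_self

/-- Auxiliary statement (`quadY_sigmaC`). [folklore] -/
theorem quadY_sigmaC (N : ℝ) (p : ℂ) : quadY (sigmaC N p) = N * refY p := by
  rw [quadY_eq', sigmaC_im, refY_eq']
  linear_combination (N * p.re / 3) * sqrt3_mul_self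

/-- Auxiliary statement (`level_sigmaC`). [folklore] -/
theorem level_sigmaC (N : ℝ) (p : ℂ) : quadX (sigmaC N p) + quadY (sigmaC N p) = N * (1 - 2 * p.im / Real.sqrt 3) := by
  rw [quadX_sigmaC, quadY_sigmaC, ← mul_add, refX_add_refY]

/-- Auxiliary statement (`refX_sigmaInvC`). [folklore] -/
theorem refX_sigmaInvC {N : ℝ} (hN : N ≠ 0) (z : ℂ) : refX (sigmaInvC N z) = quadX z / N := by
  have h := quadX_sigmaC N (sigmaInvC N z)
  rw [sigmaC_sigmaInvC hN] at h
  field_simp; linarith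

/-- Auxiliary statement (`refY_sigmaInvC`). [folklore] -/
theorem refY_sigmaInvC {N : ℝ} (hN : N ≠ 0) (z : ℂ) : refY (sigmaInvC N z) = quadY z / N := by
  have h := quadY_sigmaC N (sigmaInvC N z)
  rw [sigmaC_sigmaInvC hN] at h
  field_simp; linarith

/-- Auxiliary statement (`im_eq_of_ref`): `im p = (√3/2)(1 − X(p) − Y(p))`. [folklore] -/
theorem im_eq_of_ref (p : ℂ) : p.im = Real.sqrt 3 / 2 * (1 - refX p - refY p) := by
  rw [refX_eq', refY_eq']
  linear_combination (-(p.im / 3)) * sqrt3_mul_self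

/-! ### The uniformising map of the closed canonical triangle -/

/-- **`Ψ_N = σ_N ∘ scPsiExt`** on the closed half-plane. [folklore] -/
def PsiC (N : ℝ) (w : ℂ) : ℂ := sigmaC N (scPsiExt w)

/-- Auxiliary statement (`continuousOn_PsiC`). [folklore] -/
theorem continuousOn_PsiC (N : ℝ) : ContinuousOn (PsiC N) {w : ℂ | 0 ≤ w.im} :=
  (continuous_sigmaC N).comp_continuousOn continuousOn_scPsiExt

/-- Auxiliary statement (`PsiC_eq_of_im_pos`). [folklore] -/
theorem PsiC_eq_of_im_pos (N : ℝ) {w : ℂ} (hw : 0 < w.im) : PsiC N w = sigmaC N (scPsi w) := by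
  rw [PsiC, scPsiExt_eq hw]

/-- **`Ψ_N` is injective on the closed half-plane.** [folklore] -/
theorem PsiC_injOn {N : ℝ} (hN : N ≠ 0) : InjOn (PsiC N) {w : ℂ | 0 ≤ w.im} :=
  fun _ ha _ hb h ↦ scPsiExt_injOn ha hb (sigmaC_injective hN h)

/-- **`Ψ_N` never takes the value `0`** (the apex) on the closed half-plane. [folklore] -/
theorem PsiC_ne_zero {N : ℝ} (hN : N ≠ 0) {w : ℂ} (hw : 0 ≤ w.im) : PsiC N w ≠ 0 := by
  rw [PsiC, ← sigmaC_apex N]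
  exact fun h ↦ scPsiExt_ne_apex hw (sigmaC_injective hN h)

/-- **Values of `Ψ_N`**: the side/interior classification. Interior points go to the open triangle,
`[0,1]` to the opposite side (level `N`), `(−∞,0)` to the side `quadY = 0`, `(1,∞)` to the side
`quadX = 0`. [folklore] -/
theorem PsiC_coords {N : ℝ} (hN : 0 < N) {w : ℂ} (hw : 0 ≤ w.im) :
    (0 < w.im ∧ 0 < quadX (PsiC N w) ∧ 0 < quadY (PsiC N w) ∧ quadX (PsiC N w) + quadY (PsiC N w) < N) ∨
    (w.im = 0 ∧ w.re ∈ Icc (0:ℝ) 1 ∧ quadX (PsiC N w) = N * (1 - scRatio w.re) ∧ quadY (PsiC N w) = N * scRatio w.re) ∨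
    (w.im = 0 ∧ w.re < 0 ∧ 0 < quadX (PsiC N w) ∧ quadX (PsiC N w) < N ∧ quadY (PsiC N w) = 0) ∨
    (w.im = 0 ∧ 1 < w.re ∧ quadX (PsiC N w) = 0 ∧ 0 < quadY (PsiC N w) ∧ quadY (PsiC N w) < N) := by
  unfold PsiC
  rcases scPsiExt_cases hw with ⟨h1, hm⟩ | ⟨h1, hr, hv⟩ | ⟨h1, hr, hv⟩ | ⟨h1, hr, hv⟩
  · left
    refine ⟨h1, ?_, ?_, ?_⟩
    · rw [quadX_sigmaC]; exact mul_pos hN (refX_pos_of_mem hm)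
    · rw [quadY_sigmaC]; exact mul_pos hN (refY_pos_of_mem hm)
    · rw [level_sigmaC]
      have := (strict_of_mem_refEquilateralTriangle hm).1
      have h3 := sqrt3_pos
      have : 0 < 2 * (scPsiExt w).im / Real.sqrt 3 := by positivity
      nlinarith
  · right; left
    refine ⟨h1, hr, ?_, ?_⟩
    · rw [quadX_sigmaC, hv, (ref_ofReal _).1]
    · rw [quadY_sigmaC, hv, (ref_ofReal _).2.1]
  · right; right; left
    have hs := scRatio_mem_Ioo (inv_one_sub_mem_Ioo hr)
    refine ⟨h1, hr, ?_, ?_, ?_⟩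
    · rw [quadX_sigmaC, hv, (ref_mul_apex _).1]; apply mul_pos hN; linarith [hs.1]
    · rw [quadX_sigmaC, hv, (ref_mul_apex _).1]; nlinarith [hs.2]
    · rw [quadY_sigmaC, hv, (ref_mul_apex _).2.1, mul_zero]
  · right; right; right
    have hs := scRatio_mem_Ioo (one_sub_inv_mem_Ioo hr)
    refine ⟨h1, hr, ?_, ?_, ?_⟩
    · rw [quadX_sigmaC, hv, (ref_side_point _).1, mul_zero]
    · rw [quadY_sigmaC, hv, (ref_side_point _).2.1]; apply mul_pos hN; linarith [hs.2]
    · rw [quadY_sigmaC, hv, (ref_side_point _).2.1]; nlinarith [hs.1]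

/-- Auxiliary statement (`PsiC_mem_levelRegion`). [folklore] -/
theorem PsiC_mem_levelRegion {N : ℝ} (hN : 0 < N) {w : ℂ} (hw : 0 ≤ w.im) : PsiC N w ∈ levelRegion N := by
  rcases PsiC_coords hN hw with ⟨_, hx, hy, hl⟩ | ⟨_, hr, hx, hy⟩ | ⟨_, _, hx, hxN, hy⟩ | ⟨_, _, hx, hy, hyN⟩
  · exact ⟨hx.le, hy.le, hl.le⟩
  · have hs := scRatio_mem_Icc hr
    refine ⟨by rw [hx]; exact mul_nonneg hN.le (by linarith [hs.2]), by rw [hy]; exact mul_nonneg hN.le hs.1, ?_⟩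
    rw [hx, hy]; linarith
  · exact ⟨hx.le, by rw [hy], by rw [hy, add_zero]; exact hxN.le⟩
  · exact ⟨by rw [hx], hy.le, by rw [hx, zero_add]; exact hyN.le⟩

/-- **Surjectivity onto the closed triangle minus the apex.** [folklore] -/
theorem exists_PsiC_eq {N : ℝ} (hN : 0 < N) {z : ℂ} (hz : z ∈ levelRegion N) (hz0 : z ≠ 0) :
    ∃ w : ℂ, 0 ≤ w.im ∧ PsiC N w = z := by
  have hN0 : N ≠ 0 := hN.ne'
  obtain ⟨hx, hy, hl⟩ := hz
  set p := sigmaInvC N z with hp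
  have hpz : sigmaC N p = z := sigmaC_sigmaInvC hN0 z
  have hX : refX p = quadX z / N := refX_sigmaInvC hN0 z
  have hY : refY p = quadY z / N := refY_sigmaInvC hN0 z
  have hIm : p.im = Real.sqrt 3 / 2 * (1 - refX p - refY p) := im_eq_of_ref p
  have h3 := sqrt3_pos
  -- the level cannot be `0` (else `z = 0`)
  have hlev0 : 0 < quadX z + quadY z := by
    rcases (add_nonneg hx hy).lt_or_eq with h | h
    · exact h
    · exfalso
      have hx0 : quadX z = 0 := by linarith
      have hy0 : quadY z = 0 := by linarith
      exact hz0 (eq_of_quadX_eq_of_quadY_eq (by rw [hx0]; simp [quadX]) (by rw [hy0]; simp [quadY]))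
  -- it suffices to produce `w` with `scPsiExt w = p`
  suffices h : ∃ w : ℂ, 0 ≤ w.im ∧ scPsiExt w = p by
    obtain ⟨w, hw, hwp⟩ := h
    exact ⟨w, hw, by rw [PsiC, hwp, hpz]⟩
  rcases hl.lt_or_eq with hl | hl
  · -- level `< N`
    have hXY : refX p + refY p < 1 := by
      rw [hX, hY, ← add_div, div_lt_one hN]; exact hl
    rcases hy.lt_or_eq with hy' | hy'
    · rcases hx.lt_or_eq with hx' | hx'
      · -- interior point
        have him : 0 < p.im := by rw [hIm]; apply mul_pos (by positivity); linarith
        have hmem : p ∈ refEquilateralTriangle :=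
          mem_refEquilateralTriangle_of_ref him (by rw [hX]; positivity) (by rw [hY]; positivity)
        rw [← scPsi_image_eq] at hmem
        obtain ⟨w, hw, hwp⟩ := hmem
        exact ⟨w, le_of_lt hw, by rw [scPsiExt_eq hw, hwp]⟩
      · -- side `quadX = 0`: `p = t + (1 - t) ζ` with `t = quadY z / N ∈ (0,1)`
        set t : ℝ := quadY z / N with ht
        have hX0 : refX p = 0 := by rw [hX, ← hx', zero_div]
        have ht01 : t ∈ Ioo (0:ℝ) 1 := ⟨by positivity, by rw [← hY]; linarith [hXY]⟩
        have h1t : 1 - t ∈ Icc (0:ℝ) 1 := ⟨by linarith [ht01.2], by linarith [ht01.1]⟩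
        set q := scRatioInv (1 - t) with hq
        have hq01 : q ∈ Ioo (0:ℝ) 1 := scRatioInv_mem_Ioo ⟨by linarith [ht01.2], by linarith [ht01.1]⟩
        have hq1 : 0 < 1 - q := by linarith [hq01.2]
        set v : ℝ := (1 - q)⁻¹ with hv
        have hv1 : 1 < v := by rw [hv]; exact one_lt_inv_iff₀.2 ⟨hq1, by linarith [hq01.1]⟩
        have hvq : 1 - v⁻¹ = q := by rw [hv, inv_inv]; ring
        refine ⟨(v : ℂ), by simp, ?_⟩
        rw [scPsiExt_ofReal_of_one_lt hv1, hvq, scRatio_scRatioInv h1t]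
        apply ext_ref
        · rw [(ref_side_point (1 - t)).1, hX0]
        · rw [(ref_side_point (1 - t)).2.1, hY, ht]; ring
    · -- side `quadY = 0`: `p = (1 - t) ζ` with `t = quadX z / N ∈ (0,1)`
      set t : ℝ := quadX z / N with ht
      have hY0 : refY p = 0 := by rw [hY, ← hy', zero_div]
      have ht0 : 0 < t := by rw [ht]; apply div_pos _ hN; linarith
      have ht1 : t < 1 := by rw [← hX]; linarith [hXY]
      have ht01 : t ∈ Icc (0:ℝ) 1 := ⟨ht0.le, ht1.le⟩
      set q := scRatioInv t with hq
      have hq01 : q ∈ Ioo (0:ℝ) 1 := scRatioInv_mem_Ioo ⟨ht0, ht1⟩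
      set v : ℝ := 1 - q⁻¹ with hv
      have hq' : 1 < q⁻¹ := one_lt_inv_iff₀.2 ⟨hq01.1, hq01.2⟩
      have hv0 : v < 0 := by rw [hv]; linarith
      have hvq : (1 - v)⁻¹ = q := by rw [hv, sub_sub_cancel, inv_inv]
      refine ⟨(v : ℂ), by simp, ?_⟩
      rw [scPsiExt_ofReal_of_neg hv0, hvq, scRatio_scRatioInv ht01]
      apply ext_ref
      · rw [(ref_mul_apex (1 - t)).1, hX, ht]; ring
      · rw [(ref_mul_apex (1 - t)).2.1, hY0]
  · -- level `= N`: the opposite side, `p = s ∈ [0,1]` real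
    set s : ℝ := quadY z / N with hs
    have hs01 : s ∈ Icc (0:ℝ) 1 := ⟨by positivity, by rw [hs, div_le_one hN]; linarith⟩
    obtain ⟨u, hu, hus⟩ := exists_scRatio_eq hs01
    refine ⟨(u : ℂ), by simp, ?_⟩
    rw [scPsiExt_ofReal_of_mem_Icc hu, hus]
    apply ext_ref
    · rw [(ref_ofReal s).1, hX, hs]
      field_simp
      linarith
    · rw [(ref_ofReal s).2.1, hY]

/-! ### The inverse map -/

open scoped Classical in
/-- **The inverse uniformising map** `W_N : levelRegion N ∖ {0} → {im ≥ 0}` (junk `0` elsewhere).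
[folklore] -/
def wInv (N : ℝ) (z : ℂ) : ℂ := if h : ∃ w : ℂ, 0 ≤ w.im ∧ PsiC N w = z then h.choose else 0

/-- Auxiliary statement (`wInv_spec`). [folklore] -/
theorem wInv_spec {N : ℝ} (hN : 0 < N) {z : ℂ} (hz : z ∈ levelRegion N) (hz0 : z ≠ 0) :
    0 ≤ (wInv N z).im ∧ PsiC N (wInv N z) = z := by
  have h := exists_PsiC_eq hN hz hz0
  have : wInv N z = h.choose := by rw [wInv, dif_pos h]
  rw [this]
  exact h.choose_spec

/-- Auxiliary statement (`wInv_PsiC`). [folklore] -/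
theorem wInv_PsiC {N : ℝ} (hN : 0 < N) {w : ℂ} (hw : 0 ≤ w.im) : wInv N (PsiC N w) = w := by
  have h : ∃ w' : ℂ, 0 ≤ w'.im ∧ PsiC N w' = PsiC N w := ⟨w, hw, rfl⟩
  have : wInv N (PsiC N w) = h.choose := by rw [wInv, dif_pos h]
  rw [this]
  exact PsiC_injOn hN.ne' h.choose_spec.1 hw h.choose_spec.2

/-- The punctured closed triangle `levelRegion N ∖ {0}`. [folklore] -/
def puncturedRegion (N : ℝ) : Set ℂ := levelRegion N \ {0}

/-- Auxiliary statement (`wInv_im_nonneg`). [folklore] -/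
theorem wInv_im_nonneg {N : ℝ} (hN : 0 < N) {z : ℂ} (hz : z ∈ puncturedRegion N) : 0 ≤ (wInv N z).im :=
  (wInv_spec hN hz.1 hz.2).1

/-- Auxiliary statement (`PsiC_wInv`). [folklore] -/
theorem PsiC_wInv {N : ℝ} (hN : 0 < N) {z : ℂ} (hz : z ∈ puncturedRegion N) : PsiC N (wInv N z) = z :=
  (wInv_spec hN hz.1 hz.2).2

/-- Auxiliary statement (`tendsto_PsiC_nhdsWithin_real`). [folklore] -/
theorem tendsto_sigmaC_scPsi_of_im_zero (N : ℝ) {w : ℂ} (hw : w.im = 0) :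
    Tendsto (fun w' ↦ sigmaC N (scPsi w')) (𝓝[upperHalfPlaneSet] w) (𝓝 (PsiC N w)) :=
  ((continuous_sigmaC N).continuousAt.tendsto).comp (tendsto_scPsi_scPsiExt hw)

/-- `Ψ_N(w) → 0` as `‖w‖ → ∞` on the closed half-plane (quantitative form). [folklore] -/
theorem exists_norm_PsiC_lt {N : ℝ} {ε : ℝ} (hε : 0 < ε) :
    ∃ R, ∀ w : ℂ, 0 ≤ w.im → R ≤ ‖w‖ → ‖PsiC N w‖ < ε := by
  have hσ : Tendsto (sigmaC N) (𝓝 equilateralApex) (𝓝 0) := by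
    have := (continuous_sigmaC N).continuousAt (x := equilateralApex) |>.tendsto
    rwa [sigmaC_apex] at this
  have hlim : Tendsto (fun w ↦ sigmaC N (scPsi w)) (cocompact ℂ ⊓ 𝓟 upperHalfPlaneSet) (𝓝 0) :=
    hσ.comp tendsto_scPsi_atInfty
  have hev : ∀ᶠ w in cocompact ℂ ⊓ 𝓟 upperHalfPlaneSet, ‖sigmaC N (scPsi w)‖ < ε / 2 := by
    have := hlim.eventually (Metric.ball_mem_nhds (0:ℂ) (half_pos hε))
    filter_upwards [this] with w hw
    simpa [dist_eq_norm] using hw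
  rw [Filter.eventually_inf_principal, ← Metric.cobounded_eq_cocompact,
    (Metric.hasBasis_cobounded_compl_closedBall (0:ℂ)).eventually_iff] at hev
  obtain ⟨R, -, hR⟩ := hev
  refine ⟨R + 1, fun w hw hwR ↦ ?_⟩
  have hbig : ∀ w' : ℂ, R < ‖w'‖ → 0 < w'.im → ‖sigmaC N (scPsi w')‖ < ε / 2 := fun w' h1 h2 ↦
    hR (by simp [dist_eq_norm]; exact h1) h2
  rcases hw.lt_or_eq with hw' | hw'
  · rw [PsiC_eq_of_im_pos N hw']
    exact (hbig w (by linarith) hw').trans (by linarith)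
  · -- boundary point: pass to the limit
    have hlimw := tendsto_sigmaC_scPsi_of_im_zero N hw'.symm
    haveI hne : (𝓝[upperHalfPlaneSet] w).NeBot :=
      mem_closure_iff_nhdsWithin_neBot.1 (mem_closure_upperHalfPlaneSet_iff.2 hw)
    have hle : ‖PsiC N w‖ ≤ ε / 2 := by
      refine le_of_tendsto hlimw.norm ?_
      have hopen : IsOpen {w' : ℂ | R < ‖w'‖} := isOpen_lt continuous_const continuous_norm
      filter_upwards [self_mem_nhdsWithin, mem_nhdsWithin_of_mem_nhds (hopen.mem_nhds (by simp; linarith))]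
        with w' h1 h2
      exact (hbig w' h2 h1).le
    linarith

/-! ### Continuity of the inverse map -/

/-- Auxiliary statement (`isCompact_halfDisc`). [folklore] -/
theorem isCompact_halfDisc (R : ℝ) : IsCompact {w : ℂ | 0 ≤ w.im ∧ ‖w‖ ≤ R} := by
  have : {w : ℂ | 0 ≤ w.im ∧ ‖w‖ ≤ R} = closedBall (0:ℂ) R ∩ {w : ℂ | 0 ≤ w.im} := by
    ext w; simp [and_comm]
  rw [this]
  exact (isCompact_closedBall _ _).inter_right (isClosed_le continuous_const continuous_im)

/-- Auxiliary statement (`puncturedRegion_subset`). [folklore] -/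
theorem mem_puncturedRegion_iff {N : ℝ} {z : ℂ} : z ∈ puncturedRegion N ↔ z ∈ levelRegion N ∧ z ≠ 0 := by
  simp [puncturedRegion]

/-- **The inverse map is continuous on the punctured closed triangle** (compactness and uniqueness
of cluster points). [folklore] -/
theorem continuousWithinAt_wInv {N : ℝ} (hN : 0 < N) {z₀ : ℂ} (hz₀ : z₀ ∈ puncturedRegion N) :
    ContinuousWithinAt (wInv N) (puncturedRegion N) z₀ := by
  set w₀ := wInv N z₀ with hw₀
  set l : Filter ℂ := 𝓝[puncturedRegion N] z₀ with hl
  have hz₀0 : z₀ ≠ 0 := hz₀.2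
  have hnorm : 0 < ‖z₀‖ := norm_pos_iff.2 hz₀0
  obtain ⟨R, hR⟩ := exists_norm_PsiC_lt (N := N) (half_pos hnorm)
  set s : Set ℂ := {w : ℂ | 0 ≤ w.im ∧ ‖w‖ ≤ max R 0} with hs
  have hscomp : IsCompact s := isCompact_halfDisc _
  -- eventually `wInv z ∈ s`
  have hmem : ∀ᶠ z in l, wInv N z ∈ s := by
    have hball : ball z₀ (‖z₀‖ / 2) ∈ 𝓝 z₀ := ball_mem_nhds _ (half_pos hnorm)
    filter_upwards [self_mem_nhdsWithin, mem_nhdsWithin_of_mem_nhds hball] with z hz hzb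
    refine ⟨wInv_im_nonneg hN hz, ?_⟩
    by_contra hgt
    rw [not_le] at hgt
    have h1 := hR (wInv N z) (wInv_im_nonneg hN hz) ((le_max_left _ _).trans hgt.le)
    rw [PsiC_wInv hN hz] at h1
    rw [mem_ball, dist_eq_norm] at hzb
    have := norm_sub_norm_le z₀ z
    rw [norm_sub_rev] at hzb
    linarith
  -- uniqueness of cluster points
  have huniq : ∀ x ∈ s, MapClusterPt x l (wInv N) → x = w₀ := by
    intro x hx hcl
    rw [mapClusterPt_def] at hcl
    set F := map (wInv N) l with hF
    have hFle : F ≤ 𝓟 {w : ℂ | 0 ≤ w.im} := by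
      rw [hF, le_principal_iff, mem_map]
      filter_upwards [self_mem_nhdsWithin] with z hz
      exact wInv_im_nonneg hN hz
    -- the filter `𝓝 x ⊓ F` is `NeBot`; push it forward by `PsiC`
    have hG : (𝓝 x ⊓ F).NeBot := hcl.neBot
    have hG' : 𝓝 x ⊓ F = 𝓝[{w : ℂ | 0 ≤ w.im}] x ⊓ F := by
      rw [nhdsWithin, inf_assoc, inf_comm (𝓟 _) F, inf_eq_left.2 hFle]
    have hPsi1 : Tendsto (PsiC N) (𝓝[{w : ℂ | 0 ≤ w.im}] x) (𝓝 (PsiC N x)) := continuousOn_PsiC N x hx.1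
    have hPsi2 : Tendsto (PsiC N) F (𝓝 z₀) := by
      rw [hF, tendsto_map'_iff]
      have heq : (PsiC N ∘ wInv N) =ᶠ[l] id := by
        filter_upwards [self_mem_nhdsWithin] with z hz
        exact PsiC_wInv hN hz
      exact (tendsto_id'.2 nhdsWithin_le_nhds).congr' heq.symm
    have hboth : Tendsto (PsiC N) (𝓝 x ⊓ F) (𝓝 (PsiC N x) ⊓ 𝓝 z₀) := by
      rw [hG']
      exact tendsto_inf.2 ⟨hPsi1.mono_left inf_le_left, hPsi2.mono_left inf_le_right⟩
    have hne : (𝓝 (PsiC N x) ⊓ 𝓝 z₀).NeBot := by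
      have := Filter.map_neBot (m := PsiC N) (hf := hG)
      exact Filter.neBot_of_le (f := map (PsiC N) (𝓝 x ⊓ F)) hboth
    have heq : PsiC N x = z₀ := eq_of_nhds_neBot hne
    rw [hw₀, ← heq, wInv_PsiC hN hx.1]
  exact hscomp.tendsto_nhds_of_unique_mapClusterPt hmem huniq

/-- Auxiliary statement (`continuousOn_wInv`). [folklore] -/
theorem continuousOn_wInv {N : ℝ} (hN : 0 < N) : ContinuousOn (wInv N) (puncturedRegion N) :=
  fun _ hz ↦ continuousWithinAt_wInv hN hz

/-- **Blow-up at the apex**: `‖W_N(z)‖ → ∞` as `z → 0` in the punctured triangle. [folklore] -/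
theorem eventually_lt_norm_wInv {N : ℝ} (hN : 0 < N) (R : ℝ) :
    ∀ᶠ z in 𝓝[puncturedRegion N] 0, R < ‖wInv N z‖ := by
  set s : Set ℂ := {w : ℂ | 0 ≤ w.im ∧ ‖w‖ ≤ R} with hs
  have hK : IsCompact (PsiC N '' s) :=
    (isCompact_halfDisc R).image_of_continuousOn ((continuousOn_PsiC N).mono fun w hw ↦ hw.1)
  have h0 : (0:ℂ) ∉ PsiC N '' s := by
    rintro ⟨w, hw, hw0⟩
    exact PsiC_ne_zero hN.ne' hw.1 hw0
  have hopen : (PsiC N '' s)ᶜ ∈ 𝓝 (0:ℂ) := hK.isClosed.isOpen_compl.mem_nhds h0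
  filter_upwards [self_mem_nhdsWithin, mem_nhdsWithin_of_mem_nhds hopen] with z hz hzK
  by_contra hle
  rw [not_lt] at hle
  exact hzK ⟨wInv N z, ⟨wInv_im_nonneg hN hz, hle⟩, PsiC_wInv hN hz⟩

/-! ### The open triangle and holomorphy of the inverse -/

/-- The open canonical triangle of level `N`. [folklore] -/
def openTri (N : ℝ) : Set ℂ := {z | 0 < quadX z ∧ 0 < quadY z ∧ quadX z + quadY z < N}

/-- Auxiliary statement (`continuous_quadX`). [folklore] -/
theorem continuous_quadX : Continuous quadX := by unfold quadX; fun_prop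

/-- Auxiliary statement (`continuous_quadY`). [folklore] -/
theorem continuous_quadY : Continuous quadY := by unfold quadY; fun_prop

/-- Auxiliary statement (`isOpen_openTri`). [folklore] -/
theorem isOpen_openTri (N : ℝ) : IsOpen (openTri N) := by
  unfold openTri
  exact (isOpen_lt continuous_const continuous_quadX).inter ((isOpen_lt continuous_const continuous_quadY).inter
    (isOpen_lt (continuous_quadX.add continuous_quadY) continuous_const))

/-- Auxiliary statement (`openTri_subset_puncturedRegion`). [folklore] -/
theorem openTri_subset_puncturedRegion (N : ℝ) : openTri N ⊆ puncturedRegion N := by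
  intro z hz
  refine ⟨⟨hz.1.le, hz.2.1.le, hz.2.2.le⟩, fun h0 ↦ ?_⟩
  have : quadX z = 0 := by rw [show z = 0 from h0]; simp [quadX]
  linarith [hz.1]

/-- **Side correspondence**: the position of `W_N(z)` in the closed half-plane versus the position
of `z` in the closed triangle. [folklore] -/
theorem wInv_cases {N : ℝ} (hN : 0 < N) {z : ℂ} (hz : z ∈ puncturedRegion N) :
    (0 < (wInv N z).im ∧ z ∈ openTri N) ∨
    ((wInv N z).im = 0 ∧ (wInv N z).re ∈ Icc (0:ℝ) 1 ∧ quadX z + quadY z = N) ∨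
    ((wInv N z).im = 0 ∧ (wInv N z).re < 0 ∧ quadY z = 0 ∧ quadX z < N) ∨
    ((wInv N z).im = 0 ∧ 1 < (wInv N z).re ∧ quadX z = 0 ∧ quadY z < N) := by
  have hw := wInv_im_nonneg hN hz
  have hPz := PsiC_wInv hN hz
  rcases PsiC_coords hN hw with ⟨h1, hx, hy, hl⟩ | ⟨h1, hr, hx, hy⟩ | ⟨h1, hr, _, hxN, hy⟩ | ⟨h1, hr, hx, _, hyN⟩
  · left; rw [hPz] at hx hy hl; exact ⟨h1, hx, hy, hl⟩
  · right; left; rw [hPz] at hx hy; exact ⟨h1, hr, by rw [hx, hy]; ring⟩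
  · right; right; left; rw [hPz] at hxN hy; exact ⟨h1, hr, hy, hxN⟩
  · right; right; right; rw [hPz] at hx hyN; exact ⟨h1, hr, hx, hyN⟩

/-- Auxiliary statement (`wInv_im_pos`). [folklore] -/
theorem wInv_im_pos {N : ℝ} (hN : 0 < N) {z : ℂ} (hz : z ∈ openTri N) : 0 < (wInv N z).im := by
  rcases wInv_cases hN (openTri_subset_puncturedRegion N hz) with ⟨h, _⟩ | ⟨_, _, hl⟩ | ⟨_, _, hy, _⟩ | ⟨_, _, hx, _⟩
  · exact h
  · linarith [hz.2.2]
  · linarith [hz.2.1]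
  · linarith [hz.1]

/-- Below the top level, `W_N(z)` avoids the real segment `[0, 1]`. [folklore] -/
theorem wInv_not_mem_unitInterval {N : ℝ} (hN : 0 < N) {z : ℂ} (hz : z ∈ puncturedRegion N)
    (hl : quadX z + quadY z < N) :
    0 < (wInv N z).im ∨ ((wInv N z).im = 0 ∧ ((wInv N z).re < 0 ∨ 1 < (wInv N z).re)) := by
  rcases wInv_cases hN hz with ⟨h, _⟩ | ⟨_, _, hl'⟩ | ⟨h1, hr, _, _⟩ | ⟨h1, hr, _, _⟩
  · exact Or.inl h
  · linarith
  · exact Or.inr ⟨h1, Or.inl hr⟩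
  · exact Or.inr ⟨h1, Or.inr hr⟩

/-- On the side `quadY = 0` (below the top level) `W_N(z)` is a negative real. [folklore] -/
theorem wInv_of_quadY_eq_zero {N : ℝ} (hN : 0 < N) {z : ℂ} (hz : z ∈ puncturedRegion N)
    (hl : quadX z + quadY z < N) (hy : quadY z = 0) : (wInv N z).im = 0 ∧ (wInv N z).re < 0 := by
  rcases wInv_cases hN hz with ⟨_, hm⟩ | ⟨_, _, hl'⟩ | ⟨h1, hr, _, _⟩ | ⟨_, _, hx, _⟩
  · linarith [hm.2.1]
  · linarith
  · exact ⟨h1, hr⟩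
  · exfalso
    have : z = 0 := eq_of_quadX_eq_of_quadY_eq (by rw [hx]; simp [quadX]) (by rw [hy]; simp [quadY])
    exact hz.2 this

/-- On the side `quadX = 0` (below the top level) `W_N(z)` is a real `> 1`. [folklore] -/
theorem wInv_of_quadX_eq_zero {N : ℝ} (hN : 0 < N) {z : ℂ} (hz : z ∈ puncturedRegion N)
    (hl : quadX z + quadY z < N) (hx : quadX z = 0) : (wInv N z).im = 0 ∧ 1 < (wInv N z).re := by
  rcases wInv_cases hN hz with ⟨_, hm⟩ | ⟨_, _, hl'⟩ | ⟨_, _, hy, _⟩ | ⟨h1, hr, _, _⟩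
  · linarith [hm.1]
  · linarith
  · exfalso
    have : z = 0 := eq_of_quadX_eq_of_quadY_eq (by rw [hx]; simp [quadX]) (by rw [hy]; simp [quadY])
    exact hz.2 this
  · exact ⟨h1, hr⟩

/-- **`Ψ_N` is holomorphic on `ℍ`** with derivative `N(ζ − 1)·Ψ'(w)`. [folklore] -/
theorem hasDerivAt_PsiC (N : ℝ) {w : ℂ} (hw : 0 < w.im) :
    HasDerivAt (PsiC N) ((N : ℂ) * (dirSixty - 1) * (scDeriv w / incBeta13 1)) w := by
  have h := (hasDerivAt_sigmaC N (scPsi w)).comp w (hasDerivAt_scPsi hw)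
  refine h.congr_of_eventuallyEq ?_
  filter_upwards [isOpen_upperHalfPlaneSet.mem_nhds hw] with w' hw'
  exact PsiC_eq_of_im_pos N hw'

/-- Auxiliary statement (`PsiC_deriv_ne_zero`). [folklore] -/
theorem PsiC_deriv_ne_zero {N : ℝ} (hN : N ≠ 0) {w : ℂ} (hw : 0 < w.im) :
    (N : ℂ) * (dirSixty - 1) * (scDeriv w / incBeta13 1) ≠ 0 := by
  refine mul_ne_zero (mul_ne_zero (ofReal_ne_zero.2 hN) dirSixty_sub_one_ne_zero) ?_
  exact div_ne_zero (scDeriv_ne_zero (upperHalfPlaneSet_subset_scDomain hw) (Or.inr (ne_of_gt hw)))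
    incBeta13_one_ne_zero_complex

/-- Auxiliary statement (`continuousAt_wInv`). [folklore] -/
theorem continuousAt_wInv {N : ℝ} (hN : 0 < N) {z : ℂ} (hz : z ∈ openTri N) : ContinuousAt (wInv N) z :=
  (continuousWithinAt_wInv hN (openTri_subset_puncturedRegion N hz)).continuousAt
    (mem_of_superset ((isOpen_openTri N).mem_nhds hz) (openTri_subset_puncturedRegion N))

/-- **The inverse map is holomorphic on the open triangle** with the inverse-function derivative.
[folklore] -/
theorem hasDerivAt_wInv {N : ℝ} (hN : 0 < N) {z : ℂ} (hz : z ∈ openTri N) :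
    HasDerivAt (wInv N) ((N : ℂ) * (dirSixty - 1) * (scDeriv (wInv N z) / incBeta13 1))⁻¹ z := by
  have him := wInv_im_pos hN hz
  refine HasDerivAt.of_local_left_inverse (continuousAt_wInv hN hz) (hasDerivAt_PsiC N him)
    (PsiC_deriv_ne_zero hN.ne' him) ?_
  filter_upwards [(isOpen_openTri N).mem_nhds hz] with y hy
  exact PsiC_wInv hN (openTri_subset_puncturedRegion N hy)

/-- Auxiliary statement (`differentiableOn_wInv`). [folklore] -/
theorem differentiableOn_wInv {N : ℝ} (hN : 0 < N) : DifferentiableOn ℂ (wInv N) (openTri N) :=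
  fun _ hz ↦ (hasDerivAt_wInv hN hz).differentiableAt.differentiableWithinAt

/-- `levelRegion M ∖ {0} ⊆ puncturedRegion N` for `M ≤ N`. [folklore] -/
theorem levelRegion_diff_subset {M N : ℝ} (h : M ≤ N) : levelRegion M \ {0} ⊆ puncturedRegion N :=
  fun _ hz ↦ ⟨levelRegion_mono h hz.1, hz.2⟩

/-- **The top side**: for `u ∈ [0,1]`, `Ψ_N(u) = oppositeSideParam N (scRatio u)` and so
`W_N(oppositeSideParam N s) = scRatioInv s` for `s ∈ [0, 1]`. [folklore] -/
theorem PsiC_ofReal_of_mem_Icc (N : ℝ) {u : ℝ} (hu : u ∈ Icc (0:ℝ) 1) :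
    PsiC N u = oppositeSideParam N (scRatio u) := by
  rw [PsiC, scPsiExt_ofReal_of_mem_Icc hu, sigmaC_ofReal]

/-- Auxiliary statement (`wInv_oppositeSideParam`). [folklore] -/
theorem wInv_oppositeSideParam {N : ℝ} (hN : 0 < N) {s : ℝ} (hs : s ∈ Icc (0:ℝ) 1) :
    wInv N (oppositeSideParam N s) = ((scRatioInv s : ℝ) : ℂ) := by
  have h := PsiC_ofReal_of_mem_Icc N (scRatioInv_mem hs)
  rw [scRatio_scRatioInv hs] at h
  rw [← h, wInv_PsiC hN (by simp)]

end Literature.Probability.RandomPlanarGeometry
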